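import Mathlib
import HarnessLib
import Summits.HubbardSuperconductivity.HubbardSuperconductivity.Theorems.KLProgrammeKLRegimeSplitLegDressing

/-!
# Route `KLProgramme` — crux K3 split, ENGINE child (gen 3): the (D) term from FACTOR BOUNDS to the CLAUSE — the algebraic reduction of the
# leg-dressing part of a value increment to `legDressBarQ G P Q U n (count)` (cell gate-hubbard-kl, seat hubbard-kl-k3c2-p3, row «leg-dress bar»)

What an engine proof of (E2″-v6) / (E2′-S3) (and of (E2-v7)'s scale-`0` conjunct) does with the (D) term, once ITS expansion has isolated it:
`λ_n − λ_{n−1} = (Σ_i ζ_i)·λ_{n−1} + ρ` with `ζ_i` the per-leg dressing factors (zero off the counted window, `…SplitLegDressing`) and `ρ` the rest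
(gains + `eremBar` + `thermalBar`).  This module is the bookkeeping after that point — pure algebra over `ℂ`/`ℝ`, no model input:
* `klld_norm_increment_le_of_dressing` — `‖λ_n − λ_{n−1}‖ ≤ ‖ρ‖ + ‖λ_{n−1}‖·Σ_i ‖ζ_i‖`;
* `klld_value_times_size_le_legDressBarQ` — the VALUE line `‖λ_{n−1}‖ ≤ Klam·|U|` times a per-leg size of the shape
  `a·|U|·4^{−n} + b·U²` (residual + the engine's own second-order slope/field sizes) is `≤ legDressBarQ G P Q U n 1` as soon as
  `Klam·a ≤ Q.CR·Klam²` and `Klam·b ≤ Q.CR·Klam³` — i.e. `Q.CR ≥ a/Klam` and `Q.CR ≥ b/Klam²` (Q is chosen after R: `a = 64·cr`, `b = b(G, Gfr)`);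
* `klld_legDressBarQ_one_mul` — `legDressBarQ … n 1 · c = legDressBarQ … n c`; with `klld_norm_increment_le_of_dressing` and a count bound
  `Σ_i ‖ζ_i‖ ≤ size·c` this yields the clause's `… + legDressBarQ G P Q U n c` (`klld_dressing_term_le_legDressBarQ`).
Nothing about the model is asserted.
-/

noncomputable section

namespace Summit.HubbardSuperconductivity.HubbardSuperconductivity.Theorems.KLRegimeSplit

set_option linter.dupNamespace false -- summit = problem name (single-conjunct summit), D-0017

open Real Finset

/-- **Increment = dressing × old value + rest**: `‖λ' − λ‖ ≤ ‖ρ‖ + ‖λ‖·Σ_i ‖ζ_i‖` whenever `λ' − λ = (Σ_i ζ_i)·λ + ρ`. -/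
theorem klld_norm_increment_le_of_dressing {ι : Type*} [Fintype ι] {lam lam' ρ : ℂ} {ζ : ι → ℂ}
    (h : lam' - lam = (∑ i, ζ i) * lam + ρ) : ‖lam' - lam‖ ≤ ‖ρ‖ + ‖lam‖ * ∑ i, ‖ζ i‖ := by
  rw [h]
  calc ‖(∑ i, ζ i) * lam + ρ‖ ≤ ‖(∑ i, ζ i) * lam‖ + ‖ρ‖ := norm_add_le _ _
    _ = ‖∑ i, ζ i‖ * ‖lam‖ + ‖ρ‖ := by rw [norm_mul]
    _ ≤ (∑ i, ‖ζ i‖) * ‖lam‖ + ‖ρ‖ := by gcongr; exact norm_sum_le _ _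
    _ = ‖ρ‖ + ‖lam‖ * ∑ i, ‖ζ i‖ := by ring

/-- `legDressBarQ` is linear in the count: `legDressBarQ … n 1 · c = legDressBarQ … n c`. -/
theorem klld_legDressBarQ_one_mul (G : GeoConsts) (P : SplitConsts) (Q : EngConsts) (U : ℝ) (n c : ℕ) :
    legDressBarQ G P Q U n 1 * (c : ℝ) = legDressBarQ G P Q U n c := by
  unfold legDressBarQ; push_cast; ring

/-- **Value × per-leg size ≤ `legDressBarQ … n 1`**: if `‖λ‖ ≤ Klam·|U|`, the per-leg dressing size is `a·|U|·(4^n)⁻¹ + b·U²` with `a, b ≥ 0`,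
and the engine constant satisfies `a ≤ Q.CR·Klam`, `b ≤ Q.CR·Klam²` (`Klam ≥ 0`), then `‖λ‖·(a·|U|·(4^n)⁻¹ + b·U²) ≤ legDressBarQ G P Q U n 1`. -/
theorem klld_value_times_size_le_legDressBarQ (G : GeoConsts) {P : SplitConsts} {Q : EngConsts} (hK : 0 ≤ P.Klam) {U a b v : ℝ}
    (ha : 0 ≤ a) (hb : 0 ≤ b) (hval : v ≤ P.Klam * |U|) (haQ : a ≤ Q.CR * P.Klam) (hbQ : b ≤ Q.CR * P.Klam ^ 2) (n : ℕ) :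
    v * (a * |U| * ((4 : ℝ) ^ n)⁻¹ + b * U ^ 2) ≤ legDressBarQ G P Q U n 1 := by
  unfold legDressBarQ
  have hU : 0 ≤ |U| := abs_nonneg U
  have h4 : 0 ≤ ((4 : ℝ) ^ n)⁻¹ := by positivity
  have hU2 : U ^ 2 = |U| ^ 2 := (sq_abs U).symm
  rw [hU2]
  have hsize : 0 ≤ a * |U| * ((4 : ℝ) ^ n)⁻¹ + b * |U| ^ 2 := by positivity
  -- `v·size ≤ Klam|U|·size ≤ Q.CR·((Klam U)²4⁻ⁿ + (Klam|U|)³)`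
  calc v * (a * |U| * ((4 : ℝ) ^ n)⁻¹ + b * |U| ^ 2) ≤ P.Klam * |U| * (a * |U| * ((4 : ℝ) ^ n)⁻¹ + b * |U| ^ 2) :=
        mul_le_mul_of_nonneg_right hval hsize
    _ = (P.Klam * a) * |U| ^ 2 * ((4 : ℝ) ^ n)⁻¹ + (P.Klam * b) * |U| ^ 3 := by ring
    _ ≤ (Q.CR * P.Klam ^ 2) * |U| ^ 2 * ((4 : ℝ) ^ n)⁻¹ + (Q.CR * P.Klam ^ 3) * |U| ^ 3 := by
        have h1 : P.Klam * a ≤ Q.CR * P.Klam ^ 2 := by nlinarith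
        have h2 : P.Klam * b ≤ Q.CR * P.Klam ^ 3 := by nlinarith
        have hU3 : 0 ≤ |U| ^ 3 := by positivity
        have hU2' : 0 ≤ |U| ^ 2 * ((4 : ℝ) ^ n)⁻¹ := by positivity
        nlinarith
    _ = Q.CR * ((P.Klam * U) ^ 2 * ((4 : ℝ) ^ n)⁻¹ + (P.Klam * |U|) ^ 3) * ((1 : ℕ) : ℝ) := by
        rw [show (P.Klam * U) ^ 2 = P.Klam ^ 2 * |U| ^ 2 by rw [mul_pow, sq_abs], mul_pow]
        push_cast; ring

/-- **THE (D) TERM OF A VALUE CLAUSE, from the decomposition to the majorant.**  If the increment decomposes as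
`λ' − λ = (Σ_i ζ_i)·λ + ρ` with `‖ρ‖ ≤ B`, the old value obeys `‖λ‖ ≤ v ≤ Klam|U|`, the dressing factors are bounded in sum by a per-leg size
times a count, `Σ_i ‖ζ_i‖ ≤ (a|U|4^{−n} + bU²)·c`, and `Q.CR` dominates (`a ≤ Q.CR·Klam`, `b ≤ Q.CR·Klam²`), then
`‖λ' − λ‖ ≤ B + legDressBarQ G P Q U n c`. -/
theorem klld_dressing_term_le_legDressBarQ {ι : Type*} [Fintype ι] (G : GeoConsts) {P : SplitConsts} {Q : EngConsts} (hK : 0 ≤ P.Klam)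
    {U a b v B : ℝ} (ha : 0 ≤ a) (hb : 0 ≤ b) (hv : 0 ≤ v) (hval : v ≤ P.Klam * |U|) (haQ : a ≤ Q.CR * P.Klam)
    (hbQ : b ≤ Q.CR * P.Klam ^ 2) {n c : ℕ} {lam lam' ρ : ℂ} {ζ : ι → ℂ} (h : lam' - lam = (∑ i, ζ i) * lam + ρ) (hρ : ‖ρ‖ ≤ B)
    (hlam : ‖lam‖ ≤ v) (hζ : ∑ i, ‖ζ i‖ ≤ (a * |U| * ((4 : ℝ) ^ n)⁻¹ + b * U ^ 2) * (c : ℝ)) :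
    ‖lam' - lam‖ ≤ B + legDressBarQ G P Q U n c := by
  have h1 := klld_norm_increment_le_of_dressing h
  have hsize : 0 ≤ a * |U| * ((4 : ℝ) ^ n)⁻¹ + b * U ^ 2 := by positivity
  have h2 : ‖lam‖ * ∑ i, ‖ζ i‖ ≤ v * ((a * |U| * ((4 : ℝ) ^ n)⁻¹ + b * U ^ 2) * (c : ℝ)) :=
    mul_le_mul hlam hζ (sum_nonneg fun i _ => norm_nonneg _) hv
  have h3 : v * ((a * |U| * ((4 : ℝ) ^ n)⁻¹ + b * U ^ 2) * (c : ℝ)) ≤ legDressBarQ G P Q U n c := by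
    rw [← mul_assoc, ← klld_legDressBarQ_one_mul]
    exact mul_le_mul_of_nonneg_right (klld_value_times_size_le_legDressBarQ G hK ha hb hval haQ hbQ n) (Nat.cast_nonneg c)
  linarith

end Summit.HubbardSuperconductivity.HubbardSuperconductivity.Theorems.KLRegimeSplit

end
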